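import Mathlib
import HarnessLib
import Literature.MathematicalPhysics.KineticTheory.VelocityFlipNoise
import Summits.AtomisticToContinuum.FouriersLaw.Theorems.VanishingNoiseTransferNoisyFourierAbelTransfer
import Summits.AtomisticToContinuum.FouriersLaw.Theorems.VanishingNoiseTransferNoisyFourierFixedAbelTLOfRowLocality

/-!
# Stub A4 `stub_fixedAbelThermodynamicLimit` (line `abel-storage-decay`, crux `VanishingNoiseTransfer.NoisyFourier`,
# stmt-AtomisticToContinuum-11977): the free `ℓ²` row bound, and the reduction to BULK ROW HOMOGENEITY alone

`--supports stmt-AtomisticToContinuum-11977` file (worker A4 of lead c6). Setting as in `…NoisyFourierAbelTransfer`: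
the pinned anharmonic chain `𝐏 = pinnedChain ω₂ lam β γ` (parameters `> 0`), `T > 0`, Gibbs measure
`μ_T = 𝐏.gibbsMeasure L T` (invariant under every single-site momentum flip `F_k = momentumFlip k`), flip-noisy
equilibrium generator `L_ε = 𝐏.flipGenerator L T T ε` (`ε > 0`), bond currents `j_i = 𝐏.bondCurrent L i`
(`j_i = −½(p_i + p_{i+1})V'(q_{i+1} − q_i)`, `j_{L−1} = 0`), `J_L = Σ_i j_i`, and CLASSICAL Abel correctors
`u ∈ C² ∩ L²(μ_T)`, `L_ε u = s u − J_L` pointwise. The ROWS of the Abel–Green–Kubo pairing are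
`a_L(i) := ∫ j_i · u dμ_T`, so `σ_L(s) = ∫ J_L u dμ_T = Σ_i a_L(i)`.

The registered stub A4 (`(Σ_i a_L(i))/(L − 1)` converges as `L → ∞` at fixed `s ∈ (0,1]`) was reduced by lead
c4's worker (`helper_fixedAbelTLOfAbelRowLocality`, file `…FixedAbelTLOfRowLocality`) to `AbelRowLocality` =
(i) an `L`-uniform row bound `|a_L(i)| ≤ B` AND (ii) bulk row homogeneity. This file removes hypothesis (i):

* `AbelRow.sum_sq_integral_bondCurrent_mul_le` — **the `ℓ²` row bound, abstract form**: for ANY measure `μ` on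
  phase space invariant under every `F_k`, half currents `p_k V'(q_j − q_i) ∈ L²(μ)` with second moments `≤ M₁`,
  and `u ∈ L²(μ)`: `Σ_i (∫ j_i u dμ)² ≤ (M₁/4) · E(u)`, `E(u) = Σ_k ∫ (u∘F_k − u)² dμ` the flip Dirichlet
  energy. Mechanism (Bernardin–Olla 2011 §3, as in the landed `AbelTransfer.abs_integral_mul_totalCurrent_le`):
  `j_i` is minus half the sum of the half currents `p_i V'(q_{i+1} − q_i)` (odd under `F_i`) and
  `p_{i+1} V'(q_{i+1} − q_i)` (odd under `F_{i+1}`), pairing `u` with an `F_k`-odd `h` costs only the `F_k`-odd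
  part of `u` (`(∫ u h)² ≤ ¼ ‖u∘F_k − u‖² ‖h‖²`, `FlipCeiling.sq_integral_mul_le_of_odd`), so
  `a_L(i)² ≤ M₁ (E_i(u) + E_{i+1}(u))/8`, and each site serves at most two bonds.
* `AbelRow.corrector_rowSq_le`, `AbelRow.exists_rowSqBound` — for a classical Abel corrector at ANY `s ≥ 0` the
  landed flip-energy bound `E(u) ≤ L M₁/ε²` (`AbelTransfer.corrector_flipEnergy_le`) gives
  `Σ_i a_L(i)² ≤ L M₁²/(4ε²)`: the row vector is `O(1)` in `ℓ²`-average, uniformly in `L` and `s` — FREE, no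
  locality (a uniform bound on EACH row, c4's (i), would need each `E_k(u)` bounded, i.e. locality).
* `AbelRow.tendsto_rowAverage_of_sqBound` — the averaging step with the `ℓ²` bound in place of the sup bound:
  the `≤ 2R` boundary rows contribute `≤ √(2R) √(C L) = o(L)` (Cauchy–Schwarz, `card_filter_not_deep_le`).
* `helper_fixedAbelTLOfBulkRowHomogeneity` (registered) — **A4 ⇐ BULK ROW HOMOGENEITY ALONE**: hypothesis (ii)
  of c4's `AbelRowLocality`, verbatim (`∃ K, ∀ η > 0, ∃ R L₀, ∀ L ≥ L₀, ∀ i, R ≤ i → i + R < L →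
  |a_L(i) − K| ≤ η`), implies the registered signature of `stub_fixedAbelThermodynamicLimit` verbatim;
  `helper_abelRowSqBound` (registered) — notation-free restatement of `AbelRow.exists_rowSqBound`.

Open for A4: (ii) only — an `L²(μ_T)` light cone of the FLIP dynamics at the fixed time horizon `1/s` plus bulk
homogeneity (infinite-volume matching); the tree has these for the flip-free chain only. References:
Bernardin–Olla 2011 §3; folklore. No definitions; axioms `propext`, `Classical.choice`, `Quot.sound` only.
-/

noncomputable section

open MeasureTheory Filter Topology
open scoped BigOperators
open Literature.MathematicalPhysics.KineticTheory.HeatConduction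
open Summit.AtomisticToContinuum.FouriersLaw.Theorems.VanishingNoiseBound (gibbs_flipInvariant)
open Summit.AtomisticToContinuum.FouriersLaw.Theorems.NoisyFourier.FlipCeiling
  (gibbsHalfCurrentSqLe sq_integral_mul_le_of_odd)
open Summit.AtomisticToContinuum.FouriersLaw.Theorems.NoiseLocality.StubResponseDensityNoisy
  (memLp_bondCurrent_gibbsMeasure)

namespace Summit.AtomisticToContinuum.FouriersLaw.Cruxes.NoisyFourier.AbelKapitzaEvenCorrector

open AbelTransfer (corrector_flipEnergy_le sum_ite_succ_le_one sum_ite_pred_le_one)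

namespace AbelRow

/-! ## The `ℓ²` row bound for a flip-invariant measure -/

section Pairing

variable {L : ℕ}

/-- The row integrand `j_i · u` as a sum over the (at most one) right neighbour `j = i + 1` of the two half-current
pairings: `j_i u = Σ_{j = i+1} −½ (u · p_i V'(q_j − q_i) + u · p_j V'(q_j − q_i))`. [folklore] -/
theorem bondCurrent_mul_eq_sum_filter (P : OscillatorChain) (i : Fin L) (u : PhaseSpace L → ℝ)
    (x : PhaseSpace L) :
    P.bondCurrent L i x * u x = ∑ j ∈ Finset.univ.filter (fun j : Fin L => j.val = i.val + 1),
      -(1 / 2) * (u x * (x.2 i * deriv P.V (x.1 j - x.1 i)) + u x * (x.2 j * deriv P.V (x.1 j - x.1 i))) := by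
  unfold OscillatorChain.bondCurrent
  rw [Finset.sum_mul, Finset.sum_filter]
  refine Finset.sum_congr rfl fun j _ => ?_
  split_ifs <;> ring

/-- At most one site is the right neighbour of a given site (as a cardinality). [folklore] -/
theorem card_filter_succ_le_one (i : Fin L) :
    (Finset.univ.filter (fun j : Fin L => j.val = i.val + 1)).card ≤ 1 :=
  Finset.card_le_one.2 fun a ha b hb => by
    simp only [Finset.mem_filter, Finset.mem_univ, true_and] at ha hb
    exact Fin.ext (by omega)

/-- **The `ℓ²` row bound (abstract form).** For a measure `μ` on phase space invariant under every velocity flip,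
half currents `p_k V'(q_j − q_i) ∈ L²(μ)` with second moments `≤ M₁`, and `u ∈ L²(μ)`:
`Σ_i (∫ j_i u dμ)² ≤ (M₁/4) Σ_k ∫ (u∘F_k − u)² dμ`. Each half current is odd under ONE flip, so pairing it with
`u` costs only the corresponding odd part of `u` (`sq_integral_mul_le_of_odd`): `(∫ j_i u)² ≤ M₁(E_i + E_{i+1})/8`,
and every site serves at most two bonds. [cite: BernardinOlla2011, §3] -/
theorem sum_sq_integral_bondCurrent_mul_le (P : OscillatorChain) {μ : Measure (PhaseSpace L)}
    (hμ : ∀ i, MeasurePreserving (momentumFlip i) μ μ) {M₁ : ℝ}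
    (hM : ∀ k i j : Fin L, MemLp (fun x : PhaseSpace L => x.2 k * deriv P.V (x.1 j - x.1 i)) 2 μ ∧
      ∫ x, (x.2 k * deriv P.V (x.1 j - x.1 i)) ^ 2 ∂μ ≤ M₁)
    {u : PhaseSpace L → ℝ} (hu : MemLp u 2 μ) :
    ∑ i, (∫ x, P.bondCurrent L i x * u x ∂μ) ^ 2 ≤
      M₁ / 4 * ∑ i, ∫ x, (u (momentumFlip i x) - u x) ^ 2 ∂μ := by
  -- adapted from `AbelTransfer.abs_integral_mul_totalCurrent_le` (…NoisyFourierAbelTransferAux1): rows instead of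
  -- the total current
  rcases Nat.eq_zero_or_pos L with hL0 | hL0
  · subst hL0; simp
  have hM0 : 0 ≤ M₁ := (integral_nonneg fun x => sq_nonneg _).trans (hM ⟨0, hL0⟩ ⟨0, hL0⟩ ⟨0, hL0⟩).2
  set d : Fin L → ℝ := fun k => ∫ x, (u (momentumFlip k x) - u x) ^ 2 ∂μ with hd
  have hd0 : ∀ k, 0 ≤ d k := fun k => integral_nonneg fun x => sq_nonneg _
  -- the half currents
  set a : Fin L → Fin L → PhaseSpace L → ℝ := fun i j x => x.2 i * deriv P.V (x.1 j - x.1 i) with ha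
  set b : Fin L → Fin L → PhaseSpace L → ℝ := fun i j x => x.2 j * deriv P.V (x.1 j - x.1 i) with hb
  have haL : ∀ i j, MemLp (a i j) 2 μ := fun i j => (hM i i j).1
  have hbL : ∀ i j, MemLp (b i j) 2 μ := fun i j => (hM j i j).1
  -- pairing with a half current odd under the flip `F_k`
  have hhalf : ∀ (k : Fin L) (h : PhaseSpace L → ℝ), MemLp h 2 μ → (∫ x, h x ^ 2 ∂μ ≤ M₁) →
      (∀ x, h (momentumFlip k x) = -h x) → (∫ x, u x * h x ∂μ) ^ 2 ≤ 1 / 4 * d k * M₁ := by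
    intro k h hh hhM hodd
    refine (sq_integral_mul_le_of_odd (hμ k) hu hh hodd).trans ?_
    have : 0 ≤ 1 / 4 * d k := by have := hd0 k; positivity
    simpa only [hd] using mul_le_mul_of_nonneg_left hhM this
  have hca : ∀ i j, (∫ x, u x * a i j x ∂μ) ^ 2 ≤ 1 / 4 * d i * M₁ := fun i j =>
    hhalf i (a i j) (haL i j) (hM i i j).2 fun x => by
      simp only [ha, momentumFlip_fst, momentumFlip_snd_self]; ring
  have hcb : ∀ i j, (∫ x, u x * b i j x ∂μ) ^ 2 ≤ 1 / 4 * d j * M₁ := fun i j =>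
    hhalf j (b i j) (hbL i j) (hM j i j).2 fun x => by
      simp only [hb, momentumFlip_fst, momentumFlip_snd_self]; ring
  -- the bond constants `c_ij = -½ (∫ u a_ij + ∫ u b_ij)` and their squares
  set c : Fin L → Fin L → ℝ := fun i j => -(1 / 2) * ((∫ x, u x * a i j x ∂μ) + ∫ x, u x * b i j x ∂μ) with hc
  have hcsq : ∀ i j, c i j ^ 2 ≤ M₁ * (d i + d j) / 8 := by
    intro i j
    have h1 := hca i j
    have h2 := hcb i j
    simp only [hc]
    nlinarith [sq_nonneg ((∫ x, u x * a i j x ∂μ) - ∫ x, u x * b i j x ∂μ)]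
  -- each row is the sum of `c_ij` over the (at most one) right neighbour
  set S : Fin L → Finset (Fin L) := fun i => Finset.univ.filter (fun j : Fin L => j.val = i.val + 1) with hS
  have hrow : ∀ i, ∫ x, P.bondCurrent L i x * u x ∂μ = ∑ j ∈ S i, c i j := by
    intro i
    have ia : ∀ j, Integrable (fun x => u x * a i j x) μ := fun j => hu.integrable_mul (haL i j)
    have ib : ∀ j, Integrable (fun x => u x * b i j x) μ := fun j => hu.integrable_mul (hbL i j)
    have hI : ∀ j, Integrable (fun x => -(1 / 2) * (u x * a i j x + u x * b i j x)) μ := fun j =>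
      ((ia j).add (ib j)).const_mul _
    rw [show (fun x => P.bondCurrent L i x * u x) = fun x => ∑ j ∈ S i, -(1 / 2) * (u x * a i j x + u x * b i j x)
      from funext fun x => bondCurrent_mul_eq_sum_filter P i u x, integral_finsetSum _ fun j _ => hI j]
    refine Finset.sum_congr rfl fun j _ => ?_
    rw [integral_const_mul, integral_add (ia j) (ib j)]
  have hrowsq : ∀ i, (∫ x, P.bondCurrent L i x * u x ∂μ) ^ 2 ≤ ∑ j ∈ S i, M₁ * (d i + d j) / 8 := by
    intro i
    rw [hrow i]
    have h1 : (∑ j ∈ S i, c i j) ^ 2 ≤ (S i).card * ∑ j ∈ S i, c i j ^ 2 := sq_sum_le_card_mul_sum_sq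
    have h2 : ((S i).card : ℝ) ≤ 1 := by exact_mod_cast card_filter_succ_le_one i
    have h3 : 0 ≤ ∑ j ∈ S i, c i j ^ 2 := Finset.sum_nonneg fun j _ => sq_nonneg _
    have h4 : ∑ j ∈ S i, c i j ^ 2 ≤ ∑ j ∈ S i, M₁ * (d i + d j) / 8 := Finset.sum_le_sum fun j _ => hcsq i j
    nlinarith [mul_le_mul_of_nonneg_right h2 h3]
  -- summation over the bonds with the weights `[j = i + 1]`
  set w : Fin L → Fin L → ℝ := fun i j => if j.val = i.val + 1 then 1 else 0 with hw
  have hfw : ∀ (i) (f : Fin L → ℝ), ∑ j ∈ S i, f j = ∑ j, w i j * f j := by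
    intro i f
    rw [hS, Finset.sum_filter]
    refine Finset.sum_congr rfl fun j _ => ?_
    simp only [hw]
    split_ifs <;> simp
  have hwi : ∀ i, ∑ j, w i j ≤ 1 := fun i => sum_ite_succ_le_one i
  have hwj : ∀ j, ∑ i, w i j ≤ 1 := fun j => sum_ite_pred_le_one j
  have hS1 : ∑ i, ∑ j, w i j * d i ≤ ∑ i, d i := Finset.sum_le_sum fun i _ => by
    rw [← Finset.sum_mul]
    exact mul_le_of_le_one_left (hd0 i) (hwi i)
  have hS2 : ∑ i, ∑ j, w i j * d j ≤ ∑ j, d j := by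
    rw [Finset.sum_comm]
    refine Finset.sum_le_sum fun j _ => ?_
    rw [← Finset.sum_mul]
    exact mul_le_of_le_one_left (hd0 j) (hwj j)
  have hM8 : 0 ≤ M₁ / 8 := by positivity
  calc ∑ i, (∫ x, P.bondCurrent L i x * u x ∂μ) ^ 2 ≤ ∑ i, ∑ j ∈ S i, M₁ * (d i + d j) / 8 :=
        Finset.sum_le_sum fun i _ => hrowsq i
    _ = ∑ i, ∑ j, w i j * (M₁ * (d i + d j) / 8) := Finset.sum_congr rfl fun i _ => hfw i _
    _ = M₁ / 8 * (∑ i, ∑ j, w i j * d i) + M₁ / 8 * (∑ i, ∑ j, w i j * d j) := by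
        have e : ∀ i j, w i j * (M₁ * (d i + d j) / 8) = M₁ / 8 * (w i j * d i) + M₁ / 8 * (w i j * d j) :=
          fun i j => by ring
        simp only [e, Finset.sum_add_distrib, ← Finset.mul_sum]
    _ ≤ M₁ / 8 * (∑ i, d i) + M₁ / 8 * (∑ j, d j) :=
        add_le_add (mul_le_mul_of_nonneg_left hS1 hM8) (mul_le_mul_of_nonneg_left hS2 hM8)
    _ = M₁ / 4 * ∑ i, d i := by ring

end Pairing

/-! ## The row bound for classical Abel correctors of the flip-noisy pinned chain -/

section Chain

variable {ω₂ lam β γ : ℝ}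

/-- **`ℓ²` row bound for an Abel corrector.** For a classical Abel corrector `u` at `s ≥ 0` of the flip-noisy pinned
chain (`ε > 0`) and half-current second moments `≤ M₁`: `Σ_i (∫ j_i u dμ_T)² ≤ L M₁²/(4ε²)` — the abstract row
bound times the flip-energy bound `E(u) ≤ L M₁/ε²`. [cite: BernardinOlla2011, §3] -/
theorem corrector_rowSq_le (hω : 0 < ω₂) (hl : 0 < lam) (hβ : 0 < β) (hγ : 0 < γ) {T : ℝ} (hT : 0 < T)
    {ε : ℝ} (hε : 0 < ε) {L : ℕ} {s : ℝ} (hs : 0 ≤ s) {u : PhaseSpace L → ℝ} (huC : ContDiff ℝ 2 u)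
    (hu2 : MemLp u 2 ((pinnedChain ω₂ lam β γ).gibbsMeasure L T))
    (hpde : ∀ x, (pinnedChain ω₂ lam β γ).flipGenerator L T T ε u x =
      s * u x - ∑ i, (pinnedChain ω₂ lam β γ).bondCurrent L i x)
    {M₁ : ℝ} (hM : ∀ k i j : Fin L,
      MemLp (fun x : PhaseSpace L => x.2 k * deriv (pinnedChain ω₂ lam β γ).V (x.1 j - x.1 i)) 2
          ((pinnedChain ω₂ lam β γ).gibbsMeasure L T) ∧
        ∫ x, (x.2 k * deriv (pinnedChain ω₂ lam β γ).V (x.1 j - x.1 i)) ^ 2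
          ∂((pinnedChain ω₂ lam β γ).gibbsMeasure L T) ≤ M₁) :
    ∑ i, (∫ x, (pinnedChain ω₂ lam β γ).bondCurrent L i x * u x ∂((pinnedChain ω₂ lam β γ).gibbsMeasure L T)) ^ 2 ≤
      L * M₁ ^ 2 / (4 * ε ^ 2) := by
  have hflip := gibbs_flipInvariant (ω₂ := ω₂) (lam := lam) (β := β) (γ := γ) L T
  have h1 := sum_sq_integral_bondCurrent_mul_le (pinnedChain ω₂ lam β γ) hflip hM hu2
  have hE := corrector_flipEnergy_le hω hl hβ hγ hT hε hs huC hu2 hpde hM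
  rcases Nat.eq_zero_or_pos L with hL0 | hL0
  · subst hL0; simp
  have hM0 : 0 ≤ M₁ := (integral_nonneg fun x => sq_nonneg _).trans (hM ⟨0, hL0⟩ ⟨0, hL0⟩ ⟨0, hL0⟩).2
  calc ∑ i, (∫ x, (pinnedChain ω₂ lam β γ).bondCurrent L i x * u x ∂((pinnedChain ω₂ lam β γ).gibbsMeasure L T)) ^ 2
      ≤ M₁ / 4 * ∑ i, ∫ x, (u (momentumFlip i x) - u x) ^ 2 ∂((pinnedChain ω₂ lam β γ).gibbsMeasure L T) := h1
    _ ≤ M₁ / 4 * (L * M₁ / ε ^ 2) := mul_le_mul_of_nonneg_left hE (by positivity)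
    _ = L * M₁ ^ 2 / (4 * ε ^ 2) := by ring

/-- **The free `ℓ²` row bound.** For the flip-noisy pinned chain (parameters `> 0`, `T > 0`, `ε > 0`) there is
`C ≥ 0` (namely `M₁²/(4ε²)`, `M₁` the `L`-uniform half-current moment bound `gibbsHalfCurrentSqLe`) with
`Σ_i (∫ j_i u dμ_T)² ≤ C·L` for EVERY length `L`, every `s ≥ 0` and every classical Abel corrector `u` at `s`: the
Abel row vector is `O(1)` in `ℓ²`-average, uniformly in `L` and `s`. [cite: BernardinOlla2011, §3] -/
theorem exists_rowSqBound (hω : 0 < ω₂) (hl : 0 < lam) (hβ : 0 < β) (hγ : 0 < γ) {T : ℝ} (hT : 0 < T)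
    {ε : ℝ} (hε : 0 < ε) :
    ∃ C : ℝ, 0 ≤ C ∧ ∀ (L : ℕ) (s : ℝ), 0 ≤ s → ∀ u : PhaseSpace L → ℝ,
      (ContDiff ℝ 2 u ∧ MemLp u 2 ((pinnedChain ω₂ lam β γ).gibbsMeasure L T) ∧
        ∀ x, (pinnedChain ω₂ lam β γ).flipGenerator L T T ε u x =
          s * u x - ∑ i : Fin L, (pinnedChain ω₂ lam β γ).bondCurrent L i x) →
      ∑ i : Fin L, (∫ x, (pinnedChain ω₂ lam β γ).bondCurrent L i x * u x
          ∂((pinnedChain ω₂ lam β γ).gibbsMeasure L T)) ^ 2 ≤ C * (L : ℝ) := by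
  obtain ⟨M₁, hM₁⟩ := gibbsHalfCurrentSqLe (ω₂ := ω₂) (lam := lam) (β := β) hω hl.le hβ.le γ hT
  refine ⟨M₁ ^ 2 / (4 * ε ^ 2), by positivity, fun L s hs u hu => ?_⟩
  have h := corrector_rowSq_le hω hl hβ hγ hT hε hs hu.1 hu.2.1 hu.2.2 fun k i j => hM₁ L k i j
  calc ∑ i : Fin L, (∫ x, (pinnedChain ω₂ lam β γ).bondCurrent L i x * u x
          ∂((pinnedChain ω₂ lam β γ).gibbsMeasure L T)) ^ 2 ≤ L * M₁ ^ 2 / (4 * ε ^ 2) := h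
    _ = M₁ ^ 2 / (4 * ε ^ 2) * (L : ℝ) := by ring

end Chain

/-! ## Averaging rows: `ℓ²` bound + bulk homogeneity -/

/-- **Averaging rows with an `ℓ²` bound and a bulk value.** If `Σ_i a_L(i)² ≤ C L` for all `L ≥ 2`, and for every
`η > 0` the `R`-deep rows of all long chains are `η`-close to `K`, then `(Σ_i a_L(i))/(L − 1) → K`: the `≤ 2R`
boundary rows contribute at most `√(2R)·√(C L) = o(L)` by Cauchy–Schwarz. [folklore] -/
theorem tendsto_rowAverage_of_sqBound {a : (L : ℕ) → Fin L → ℝ} {K C : ℝ}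
    (hC : ∀ L : ℕ, 2 ≤ L → ∑ i : Fin L, (a L i) ^ 2 ≤ C * (L : ℝ))
    (hη : ∀ η : ℝ, 0 < η → ∃ R L₀ : ℕ, ∀ L : ℕ, L₀ ≤ L → ∀ i : Fin L, R ≤ i.val → i.val + R < L →
      |a L i - K| ≤ η) :
    Tendsto (fun L : ℕ => (∑ i : Fin L, a L i) / ((L : ℝ) - 1)) atTop (nhds K) := by
  -- adapted from `tendsto_rowAverage` (…NoisyFourierFixedAbelTLOfRowLocality): the sup-row bound is replaced by
  -- the `ℓ²` bound and Cauchy–Schwarz on the boundary rows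
  classical
  rw [Metric.tendsto_atTop]
  intro ε hε
  obtain ⟨R, L₀, hRL⟩ := hη (ε / 8) (by positivity)
  have hC0 : 0 ≤ C := by
    have h := (Finset.sum_nonneg fun i _ => sq_nonneg (a 2 i)).trans (hC 2 le_rfl)
    norm_num at h
    linarith
  set M : ℝ := 4 * R * C / ε + 2 * R * |K| + |K| with hM
  have hM0 : 0 ≤ M := by positivity
  obtain ⟨L₁, hL₁⟩ : ∃ L₁ : ℕ, M < ε / 2 * ((L₁ : ℝ) - 1) := by
    obtain ⟨n, hn⟩ := exists_nat_gt (M / (ε / 2) + 1)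
    refine ⟨n, ?_⟩
    have h : M / (ε / 2) < (n : ℝ) - 1 := by linarith
    rw [div_lt_iff₀ (by positivity)] at h
    linarith
  refine ⟨max (max L₀ 2) L₁, fun L hL => ?_⟩
  have hL₀ : L₀ ≤ L := ((le_max_left _ _).trans (le_max_left _ _)).trans hL
  have h2 : 2 ≤ L := ((le_max_right _ _).trans (le_max_left _ _)).trans hL
  have hL₁' : L₁ ≤ L := (le_max_right _ _).trans hL
  have hLr : (2 : ℝ) ≤ (L : ℝ) := by exact_mod_cast h2
  have hL1pos : 0 < (L : ℝ) - 1 := by linarith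
  have hL₁r : (L₁ : ℝ) ≤ (L : ℝ) := by exact_mod_cast hL₁'
  set p : Fin L → Prop := fun i => R ≤ i.val ∧ i.val + R < L with hp
  set Sd : Finset (Fin L) := Finset.univ.filter (fun i => p i) with hSd
  set Sb : Finset (Fin L) := Finset.univ.filter (fun i => ¬p i) with hSb
  -- deep rows: each `ε/8`-close to `K`
  have hdeep : ∑ i ∈ Sd, |a L i - K| ≤ (L : ℝ) * (ε / 8) := by
    have hc1 : (Sd.card : ℝ) ≤ L := by
      have h := Finset.card_filter_le (Finset.univ : Finset (Fin L)) (fun i => p i)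
      rw [Finset.card_univ, Fintype.card_fin] at h
      exact_mod_cast h
    calc ∑ i ∈ Sd, |a L i - K| ≤ ∑ i ∈ Sd, ε / 8 := Finset.sum_le_sum fun i hi => by
            simp only [hSd, Finset.mem_filter, Finset.mem_univ, true_and] at hi
            exact hRL L hL₀ i hi.1 hi.2
      _ = (Sd.card : ℝ) * (ε / 8) := by rw [Finset.sum_const, nsmul_eq_mul]
      _ ≤ (L : ℝ) * (ε / 8) := mul_le_mul_of_nonneg_right hc1 (by positivity)
  -- boundary rows: at most `2R` of them, Cauchy–Schwarz with the `ℓ²` bound, then `√(AB) ≤ (δA + B/δ)/2`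
  have hcard : (Sb.card : ℝ) ≤ 2 * R := by exact_mod_cast card_filter_not_deep_le L R
  have hbdry : ∑ i ∈ Sb, |a L i| ≤ (L : ℝ) * (ε / 8) + 4 * R * C / ε := by
    set t : ℝ := ∑ i ∈ Sb, |a L i| with ht
    have h1 : t ^ 2 ≤ (Sb.card : ℝ) * ∑ i ∈ Sb, |a L i| ^ 2 := sq_sum_le_card_mul_sum_sq
    have h2 : ∑ i ∈ Sb, |a L i| ^ 2 ≤ C * (L : ℝ) := by
      calc ∑ i ∈ Sb, |a L i| ^ 2 ≤ ∑ i, |a L i| ^ 2 :=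
            Finset.sum_le_sum_of_subset_of_nonneg (Finset.filter_subset _ _) fun i _ _ => sq_nonneg _
        _ = ∑ i, (a L i) ^ 2 := by simp only [sq_abs]
        _ ≤ C * (L : ℝ) := hC L h2
    have h3 : t ^ 2 ≤ 2 * R * (C * (L : ℝ)) :=
      h1.trans (mul_le_mul hcard h2 (Finset.sum_nonneg fun i _ => sq_nonneg _) (by positivity))
    obtain ⟨D, hD, hDdef⟩ : ∃ D : ℝ, D * ε = 4 * R * C ∧ D = 4 * R * C / ε :=
      ⟨_, div_mul_cancel₀ _ hε.ne', rfl⟩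
    rw [← hDdef]
    have hr0 : 0 ≤ (L : ℝ) * (ε / 8) + D := by rw [hDdef]; positivity
    have hDL : (L : ℝ) * (D * ε) = (L : ℝ) * (4 * R * C) := by rw [hD]
    have key : t ^ 2 ≤ ((L : ℝ) * (ε / 8) + D) ^ 2 := by
      nlinarith [sq_nonneg ((L : ℝ) * (ε / 8) - D), hDL, h3]
    exact (le_abs_self t).trans (abs_le_of_sq_le_sq key hr0)
  -- summing it
  have hsum : |∑ i : Fin L, (a L i - K)| ≤ (L : ℝ) * (ε / 4) + (4 * R * C / ε + 2 * R * |K|) := by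
    refine (Finset.abs_sum_le_sum_abs _ _).trans ?_
    rw [← Finset.sum_filter_add_sum_filter_not Finset.univ (fun i => p i)]
    have hb2 : ∑ i ∈ Sb, |a L i - K| ≤ (L : ℝ) * (ε / 8) + 4 * R * C / ε + 2 * R * |K| := by
      calc ∑ i ∈ Sb, |a L i - K| ≤ ∑ i ∈ Sb, (|a L i| + |K|) := Finset.sum_le_sum fun i _ => abs_sub _ _
        _ = (∑ i ∈ Sb, |a L i|) + (Sb.card : ℝ) * |K| := by
            rw [Finset.sum_add_distrib, Finset.sum_const, nsmul_eq_mul]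
        _ ≤ (L : ℝ) * (ε / 8) + 4 * R * C / ε + 2 * R * |K| :=
            add_le_add hbdry (mul_le_mul_of_nonneg_right hcard (abs_nonneg _))
    linarith [hdeep, hb2]
  -- conclusion
  rw [Real.dist_eq]
  have hrew : (∑ i : Fin L, a L i) / ((L : ℝ) - 1) - K =
      ((∑ i : Fin L, (a L i - K)) + K) / ((L : ℝ) - 1) := by
    rw [Finset.sum_sub_distrib, Finset.sum_const, Finset.card_univ, Fintype.card_fin, nsmul_eq_mul]
    field_simp
    ring
  rw [hrew, abs_div, abs_of_pos hL1pos, div_lt_iff₀ hL1pos]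
  have habs : |(∑ i : Fin L, (a L i - K)) + K| ≤ (L : ℝ) * (ε / 4) + M := by
    refine (abs_add_le _ _).trans ?_
    rw [hM]
    linarith [hsum]
  have hML : M < ε / 2 * ((L : ℝ) - 1) := hL₁.trans_le (by nlinarith [hL₁r, hε.le])
  have hL4 : (L : ℝ) * (ε / 4) ≤ ε / 2 * ((L : ℝ) - 1) := by nlinarith [hLr, hε.le]
  linarith [habs, hML, hL4]

/-! ## A4 from bulk row homogeneity alone -/

section Reduction

variable {ω₂ lam β γ : ℝ}

/-- **Stub A4 from bulk row homogeneity.** If the rows `a_L(i) = ∫ j_i u_L dμ_{L,T}` of a family of classical Abel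
correctors at `s ∈ (0,1]` have a bulk value `K` (for every `η > 0` the `R`-deep rows of all long chains are
`η`-close to `K`), then `∫ J_L u_L dμ_{L,T}/(L − 1) → K`: the free `ℓ²` row bound (`exists_rowSqBound`) controls the
boundary rows (`tendsto_rowAverage_of_sqBound`), and `∫ J_L u_L = Σ_i a_L(i)`. [folklore] -/
theorem fixedAbelTL_of_bulkRowHomogeneity (hω : 0 < ω₂) (hl : 0 < lam) (hβ : 0 < β) (hγ : 0 < γ) {T : ℝ}
    (hT : 0 < T) {ε : ℝ} (hε : 0 < ε) {s : ℝ} (hs : 0 < s) {u : (L : ℕ) → PhaseSpace L → ℝ}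
    (hu : ∀ L : ℕ, 2 ≤ L → ContDiff ℝ 2 (u L) ∧ MemLp (u L) 2 ((pinnedChain ω₂ lam β γ).gibbsMeasure L T) ∧
      ∀ x, (pinnedChain ω₂ lam β γ).flipGenerator L T T ε (u L) x =
        s * u L x - ∑ i : Fin L, (pinnedChain ω₂ lam β γ).bondCurrent L i x)
    {K : ℝ} (hK : ∀ η : ℝ, 0 < η → ∃ R L₀ : ℕ, ∀ L : ℕ, L₀ ≤ L → ∀ i : Fin L, R ≤ i.val → i.val + R < L →
      |(∫ x, (pinnedChain ω₂ lam β γ).bondCurrent L i x * u L x ∂((pinnedChain ω₂ lam β γ).gibbsMeasure L T)) - K|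
        ≤ η) :
    Tendsto (fun L : ℕ => (∫ x, (∑ i : Fin L, (pinnedChain ω₂ lam β γ).bondCurrent L i x) * u L x
      ∂((pinnedChain ω₂ lam β γ).gibbsMeasure L T)) / ((L : ℝ) - 1)) atTop (nhds K) := by
  obtain ⟨C, -, hC⟩ := exists_rowSqBound (ω₂ := ω₂) (lam := lam) (β := β) (γ := γ) hω hl hβ hγ hT hε
  set P := pinnedChain ω₂ lam β γ with hP
  -- `∫ J_L u_L = Σ_i ∫ j_i u_L` for `L ≥ 2`
  have key : ∀ L : ℕ, 2 ≤ L →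
      (∫ x, (∑ i : Fin L, P.bondCurrent L i x) * u L x ∂(P.gibbsMeasure L T)) =
        ∑ i : Fin L, ∫ x, P.bondCurrent L i x * u L x ∂(P.gibbsMeasure L T) := by
    intro L hL
    have hint : ∀ i : Fin L, Integrable (fun x => P.bondCurrent L i x * u L x) (P.gibbsMeasure L T) :=
      fun i => (memLp_bondCurrent_gibbsMeasure hω hl.le hβ.le γ L hT i).integrable_mul (hu L hL).2.1
    rw [← integral_finsetSum _ fun i _ => hint i]
    refine integral_congr_ae (ae_of_all _ fun x => ?_)
    simp only [Finset.sum_mul]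
  have h := tendsto_rowAverage_of_sqBound
    (a := fun L i => ∫ x, P.bondCurrent L i x * u L x ∂(P.gibbsMeasure L T)) (K := K) (C := C)
    (fun L hL => hC L s hs.le (u L) (hu L hL)) hK
  refine h.congr' ?_
  filter_upwards [eventually_ge_atTop 2] with L hL
  rw [key L hL]

end Reduction

end AbelRow

/-! ## Registered helpers (notation-free restatements) -/

/-- Registered helper sub-goal `helper_abelRowSqBound` of stub `stub_fixedAbelThermodynamicLimit` (line
`abel-storage-decay`, crux stmt-AtomisticToContinuum-11977): the FREE `ℓ²` ROW BOUND — for the flip-noisy pinned chain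
there is `C ≥ 0` with `Σ_i (∫ j_i u dμ_T)² ≤ C·L` for every `L`, every `s ≥ 0` and every classical Abel corrector
`u` at `s` (`AbelRow.exists_rowSqBound`, restated). [cite: BernardinOlla2011, §3] -/
theorem helper_abelRowSqBound : ∀ (ω₂ lam β γ T ε : ℝ), 0 < ω₂ → 0 < lam → 0 < β → 0 < γ → 0 < T → 0 < ε → ∃ C : ℝ, 0 ≤ C ∧ ∀ (L : ℕ) (s : ℝ), 0 ≤ s → ∀ u : Literature.MathematicalPhysics.KineticTheory.HeatConduction.PhaseSpace L → ℝ, (ContDiff ℝ 2 u ∧ MeasureTheory.MemLp u 2 ((Literature.MathematicalPhysics.KineticTheory.HeatConduction.pinnedChain ω₂ lam β γ).gibbsMeasure L T) ∧ ∀ x, (Literature.MathematicalPhysics.KineticTheory.HeatConduction.pinnedChain ω₂ lam β γ).flipGenerator L T T ε u x = s * u x - ∑ i : Fin L, (Literature.MathematicalPhysics.KineticTheory.HeatConduction.pinnedChain ω₂ lam β γ).bondCurrent L i x) → ∑ i : Fin L, (MeasureTheory.integral ((Literature.MathematicalPhysics.KineticTheory.HeatConduction.pinnedChain ω₂ lam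 β γ).gibbsMeasure L T) (fun x => (Literature.MathematicalPhysics.KineticTheory.HeatConduction.pinnedChain ω₂ lam β γ).bondCurrent L i x * u x)) ^ 2 ≤ C * (L : ℝ) :=
  fun _ _ _ _ _ _ hω hl hβ hγ hT hε => AbelRow.exists_rowSqBound hω hl hβ hγ hT hε

/-- Registered helper sub-goal `helper_fixedAbelTLOfBulkRowHomogeneity` of stub `stub_fixedAbelThermodynamicLimit`
(line `abel-storage-decay`, crux stmt-AtomisticToContinuum-11977): **A4 ⇐ BULK ROW HOMOGENEITY ALONE** — if for all
parameters, every `s ∈ (0,1]` and every family of classical Abel correctors the rows `∫ j_i u_L dμ_{L,T}` have a bulk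
value `K` (hypothesis (ii) of c4's `AbelRowLocality`, verbatim), then the registered signature of
`stub_fixedAbelThermodynamicLimit` holds verbatim (`AbelRow.fixedAbelTL_of_bulkRowHomogeneity`; the uniform row bound
(i) of `helper_fixedAbelTLOfAbelRowLocality` is not needed, the free `ℓ²` row bound replacing it). [folklore] -/
theorem helper_fixedAbelTLOfBulkRowHomogeneity : (∀ (ω₂ lam β γ T ε : ℝ), 0 < ω₂ → 0 < lam → 0 < β → 0 < γ → 0 < T → 0 < ε → ∀ s : ℝ, 0 < s → s ≤ 1 → ∀ u : (L : ℕ) → Literature.MathematicalPhysics.KineticTheory.HeatConduction.PhaseSpace L → ℝ, (∀ L : ℕ, 2 ≤ L → ContDiff ℝ 2 (u L) ∧ MeasureTheory.MemLp (u L) 2 ((Literature.MathematicalPhysics.KineticTheory.HeatConduction.pinnedChain ω₂ lam β γ).gibbsMeasure L T) ∧ ∀ x, (Literature.MathematicalPhysics.KineticTheory.HeatConduction.pinnedChain ω₂ lam β γ).flipGenerator L T T ε (u L) x = s * u L x - ∑ i : Fin L, (Literature.MathematicalPhysics.KineticTheory.HeatConduction.pinnedChain ω₂ lam β γ).bondCurrent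 L i x) → ∃ K : ℝ, ∀ η : ℝ, 0 < η → ∃ R L₀ : ℕ, ∀ L : ℕ, L₀ ≤ L → ∀ i : Fin L, R ≤ i.val → i.val + R < L → |MeasureTheory.integral ((Literature.MathematicalPhysics.KineticTheory.HeatConduction.pinnedChain ω₂ lam β γ).gibbsMeasure L T) (fun x => (Literature.MathematicalPhysics.KineticTheory.HeatConduction.pinnedChain ω₂ lam β γ).bondCurrent L i x * u L x) - K| ≤ η) → ∀ (ω₂ lam β γ T ε : ℝ), 0 < ω₂ → 0 < lam → 0 < β → 0 < γ → 0 < T → 0 < ε → ∀ s : ℝ, 0 < s → s ≤ 1 → ∀ u : (L : ℕ) → Literature.MathematicalPhysics.KineticTheory.HeatConduction.PhaseSpace L → ℝ, (∀ L : ℕ, 2 ≤ L → ContDiff ℝ 2 (u L) ∧ MeasureTheory.MemLp (u L) 2 ((Literature.MathematicalPhysics.KineticTheory.HeatConduction.pinnedChain ω₂ lam β γ).gibbsMeasure L T) ∧ ∀ x, (Literature.MathematicalPhysics.KineticTheory.HeatConduction.pinnedChain ω₂ lam β γ).flipGenerator L T T ε (u L) x = s * u L x - ∑ i : Fin L, (Literature.MathematicalPhysics.KineticTheory.HeatConduction.pinnedChain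 ω₂ lam β γ).bondCurrent L i x) → ∃ K : ℝ, Filter.Tendsto (fun L : ℕ => (MeasureTheory.integral ((Literature.MathematicalPhysics.KineticTheory.HeatConduction.pinnedChain ω₂ lam β γ).gibbsMeasure L T) (fun x => (∑ i : Fin L, (Literature.MathematicalPhysics.KineticTheory.HeatConduction.pinnedChain ω₂ lam β γ).bondCurrent L i x) * u L x)) / ((L : ℝ) - 1)) Filter.atTop (nhds K) := by
  intro hX ω₂ lam β γ T ε hω hl hβ hγ hT hε s hs hs1 u hu
  obtain ⟨K, hK⟩ := hX ω₂ lam β γ T ε hω hl hβ hγ hT hε s hs hs1 u hu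
  exact ⟨K, AbelRow.fixedAbelTL_of_bulkRowHomogeneity hω hl hβ hγ hT hε hs hu hK⟩

end Summit.AtomisticToContinuum.FouriersLaw.Cruxes.NoisyFourier.AbelKapitzaEvenCorrector

end
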